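import Literature.MathematicalPhysics.QuantumLattice.SpinSectorPartitionFnTransfer
import HarnessLib

/-!
# The thermal pressure of the 2D `t–t'` Hubbard model is locally Lipschitz and concave in the density

Topic `MathematicalPhysics/QuantumLattice` (family `hubbard`); sequel of `HubbardTTPrimeThermalPressureLimit.lean`
(the number `p(β; t,t',U; n) = pressureTT' β t t' U n = lim_L L⁻² log Z_β(H^{torus}_{L×L}; k_L(n), k_L(n))`,
`k_L(n) = ⌊nL²/2⌋`) and of `SpinSectorPartitionFnTransfer.lean` (the sharp one-electron transfer on the torus).
The DENSITY leg of the positive-temperature box words (Hubbard programme S2, `n = 0.875 ± 0.01`): a pressure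
certificate at ONE density binds a whole filling interval, with an explicit modulus.

* §1 finite volume (`L × L` torus, `r = 18(2|t|+|U|) + 36|t'|`, `β ≥ 0`): every electron pair added below density
  `y < 2` changes `log Z` by at least `2 log((2−y)/y) − 4βr/(2−y)`, every pair added above density `x > 0` by at
  most `2 log(2/x) + 4βr/x` (`log_partitionFn_pair_step_ge/_le`, telescoped `…_pairs_ge/_le`);
* §2 **local Lipschitz continuity in the density** (`U ≥ 0`, `0 < x ≤ y < 2`):
  `(y − x)(log((2−y)/y) − 2βr/(2−y)) ≤ p(y) − p(x) ≤ (y − x)(log(2/x) + 2βr/x)`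
  (`density_mul_le_pressureTT'_sub`, `pressureTT'_sub_le_density_mul`), and on `[lo, hi] ⊂ (0, 2)`
  `|p(y) − p(x)| ≤ (y − x)(log(2/lo) + log(2/(2−hi)) + 2βr(1/lo + 1/(2−hi)))` (`abs_pressureTT'_sub_le_density`,
  `lipschitzOnWith_pressureTT'_density`, `continuousOn_pressureTT'_density` on `(0,2)`) — the ideal lattice-gas
  entropy slope plus `O(β)`;
* §3 **concavity at rational weights** by Ruelle's mixed tiling — `K²` blocks of side `M`, `aK` of them at density
  `x`, the rest at `y` (`prod_partitionFn_hubbardRectTorusTT'_squares_le`), the `< K²` rounding pairs priced by §1 —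
  `(a/K) p(x) + (1 − a/K) p(y) ≤ p((a x + (K−a) y)/K)` (`pressureTT'_ratConcave`);
* §4 **concavity** `ConcaveOn ℝ [0,2) (pressureTT' β t t' U)` (`concaveOn_pressureTT'_density`; real weights from §3
  and the continuity §2), and the box-word corollary `min (p x) (p y) ≤ p n` for `x ≤ n ≤ y`
  (`min_pressureTT'_le_of_mem_Icc`).

Everything is PROVED; no definition, no named fact. (Ruelle 1969 §3.4: the canonical free energy density of a
lattice gas is concave and continuous in the density on the open density interval.)

## Mathlib / tree search

REUSED: `log_partitionFn_spinSector_hubbardRectTorusTT'_succ_succ_mem` (`SpinSectorPartitionFnTransfer`),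
`tendsto_sectorPressureTT'`, `log_partitionFn_sectorHamiltonianTT'_eq_rect`, `halfRectN_lt_sq`
(`HubbardTTPrimeThermalPressureLimit`), `prod_partitionFn_hubbardRectTorusTT'_squares_le`
(`HubbardTTPrimeTorusPartitionFnTiling`), Mathlib
`le_of_tendsto_of_tendsto'`, `tendsto_const_div_atTop_nhds_zero_nat`, `ConcaveOn.ge_on_segment`, `segment_eq_Icc`.
The `T = 0` twin is `HubbardNNNHoppingEnergyDensityConvex.lean` (`convexOn_energyDensityTT'`), whose skeleton §3–§4
follow. `lean search 'concaveOn_pressureTT|pressureTT.*density'`: nothing (2026-08-27).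

## References

* D. Ruelle, *Statistical Mechanics: Rigorous Results* (1969), §3.4. [cite: Ruelle1969, §3.4]
* R. B. Israel, *Convexity in the Theory of Lattice Gases* (1979), Thm. I.2.4. [cite: Israel1979, Thm. I.2.4]
-/

noncomputable section

namespace Literature.MathematicalPhysics.QuantumLattice

open Matrix Finset HubbardWave0 Literature.Probability.LatticeModels LiebThm1
open _root_.Filter
open scoped _root_.Topology ComplexOrder BigOperators

namespace ThermodynamicLimit

/-! ### §1 Finite volume: the price of electron pairs in a density window -/

/-- `k_L` is monotone in the density. [folklore] -/
private theorem halfRectN_mono {x y : ℝ} (hxy : x ≤ y) (L : ℕ) : halfRectN x L ≤ halfRectN y L := by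
  unfold halfRectN
  exact Nat.floor_le_floor (by nlinarith [sq_nonneg (L : ℝ)])

/-- `k_L(n) ≤ nL²/2` (floor; the import-light twin of `halfRectN_le_half_mul_sq` of
`InfVolFermionStateTorusLimitTwoSectorReverseRow`). [folklore] -/
private theorem halfRectN_real_le {n : ℝ} (hn0 : 0 ≤ n) (L : ℕ) : (halfRectN n L : ℝ) ≤ n / 2 * (L : ℝ) ^ 2 := by
  unfold halfRectN
  have h := Nat.floor_le (a := n * (L : ℝ) ^ 2 / 2) (by positivity)
  linarith

/-- `nL²/2 − 1 < k_L(n)` (floor; the import-light twin of `half_mul_sq_sub_one_lt_halfRectN`). [folklore] -/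
private theorem halfRectN_real_gt (n : ℝ) (L : ℕ) : n / 2 * (L : ℝ) ^ 2 - 1 < (halfRectN n L : ℝ) := by
  unfold halfRectN
  have h := Nat.lt_floor_add_one (n * (L : ℝ) ^ 2 / 2)
  linarith

section Finite

variable (t t' U : ℝ) {β : ℝ} (hβ : 0 ≤ β)
include hβ

/-- **One pair below density `y`.** On the `N × N` torus (`N ≥ 1`), if `k + 1 ≤ k_* ≤ yN²/2` with `y < 2`, then
`2 log((2−y)/y) − 4βr/(2−y) ≤ log Z(k+1,k+1) − log Z(k,k)`. [cite: Ruelle1969, §3.4] -/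
theorem log_partitionFn_pair_step_ge {y : ℝ} (hy2 : y < 2) {N k kz : ℕ} (hN : 1 ≤ N) (hk : k + 1 ≤ kz)
    (hkz : (kz : ℝ) ≤ y / 2 * (N : ℝ) ^ 2) :
    2 * Real.log ((2 - y) / y) - 4 * β * (18 * (2 * |t| + |U|) + 36 * |t'|) / (2 - y) ≤
      Real.log (partitionFn β (spinSectorHamiltonian (k + 1) (k + 1) (hubbardRectTorusTT' N N t t' U))).re -
        Real.log (partitionFn β (spinSectorHamiltonian k k (hubbardRectTorusTT' N N t t' U))).re := by
  have hr0 : 0 ≤ 18 * (2 * |t| + |U|) + 36 * |t'| := by positivity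
  have hNN : ((N * N : ℕ) : ℝ) = (N : ℝ) ^ 2 := by push_cast; ring
  have hk1 : (k : ℝ) + 1 ≤ kz := by exact_mod_cast hk
  have hN1 : (1 : ℝ) ≤ N := by exact_mod_cast hN
  have hN2 : (1 : ℝ) ≤ (N : ℝ) ^ 2 := by nlinarith
  -- `y > 0` (a nonempty window) and `2(k+1) ≤ yN²`
  have hy0 : 0 < y := by
    by_contra h
    have : y / 2 * (N : ℝ) ^ 2 ≤ 0 := by
      have : y / 2 ≤ 0 := by linarith [not_lt.1 h]
      exact mul_nonpos_of_nonpos_of_nonneg this (by positivity)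
    linarith
  have h2y : 0 < 2 - y := by linarith
  have hkN : (k : ℝ) + 1 < (N : ℝ) ^ 2 := by nlinarith
  have hkN' : k + 1 ≤ N * N := by
    have : ((k + 1 : ℕ) : ℝ) ≤ ((N * N : ℕ) : ℝ) := by rw [hNN]; push_cast; exact hkN.le
    exact_mod_cast this
  obtain ⟨h, -⟩ := log_partitionFn_spinSector_hubbardRectTorusTT'_succ_succ_mem N N t t' U hβ hkN'
  rw [hNN] at h
  -- compare the entropy factor and the rate factor with their values at density `y`
  have hden : 0 < (N : ℝ) ^ 2 - k := by linarith
  have hent : Real.log ((2 - y) / y) ≤ Real.log (((N : ℝ) ^ 2 - k) / ((k : ℝ) + 1)) := by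
    refine Real.log_le_log (div_pos h2y hy0) ?_
    rw [div_le_div_iff₀ hy0 (by positivity)]
    nlinarith
  have hrate : β * ((N : ℝ) ^ 2 * (18 * (2 * |t| + |U|) + 36 * |t'|)) / ((N : ℝ) ^ 2 - k) ≤
      2 * β * (18 * (2 * |t| + |U|) + 36 * |t'|) / (2 - y) := by
    rw [div_le_div_iff₀ hden h2y]
    have h1 : (N : ℝ) ^ 2 * (2 - y) ≤ 2 * ((N : ℝ) ^ 2 - k) := by nlinarith
    have := mul_le_mul_of_nonneg_left h1 (mul_nonneg hβ hr0)
    nlinarith [this]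
  have e : 4 * β * (18 * (2 * |t| + |U|) + 36 * |t'|) / (2 - y) =
      2 * (2 * β * (18 * (2 * |t| + |U|) + 36 * |t'|) / (2 - y)) := by ring
  rw [e]
  linarith

/-- **One pair above density `x`.** On the `N × N` torus, if `xN²/2 < k + 1 ≤ N²` with `x > 0`, then
`log Z(k+1,k+1) − log Z(k,k) ≤ 2 log(2/x) + 4βr/x`. [cite: Ruelle1969, §3.4] -/
theorem log_partitionFn_pair_step_le {x : ℝ} (hx0 : 0 < x) {N k : ℕ} (hxk : x / 2 * (N : ℝ) ^ 2 < (k : ℝ) + 1)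
    (hk : k + 1 ≤ N * N) :
    Real.log (partitionFn β (spinSectorHamiltonian (k + 1) (k + 1) (hubbardRectTorusTT' N N t t' U))).re -
        Real.log (partitionFn β (spinSectorHamiltonian k k (hubbardRectTorusTT' N N t t' U))).re ≤
      2 * Real.log (2 / x) + 4 * β * (18 * (2 * |t| + |U|) + 36 * |t'|) / x := by
  have hr0 : 0 ≤ 18 * (2 * |t| + |U|) + 36 * |t'| := by positivity
  have hNN : ((N * N : ℕ) : ℝ) = (N : ℝ) ^ 2 := by push_cast; ring
  obtain ⟨-, h⟩ := log_partitionFn_spinSector_hubbardRectTorusTT'_succ_succ_mem N N t t' U hβ hk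
  rw [hNN] at h
  have hkN : (k : ℝ) + 1 ≤ (N : ℝ) ^ 2 := by rw [← hNN]; exact_mod_cast hk
  have hk1 : (0 : ℝ) < (k : ℝ) + 1 := by positivity
  have hent : Real.log (((N : ℝ) ^ 2 - k) / ((k : ℝ) + 1)) ≤ Real.log (2 / x) := by
    refine Real.log_le_log (div_pos (by linarith) hk1) ?_
    rw [div_le_div_iff₀ hk1 hx0]
    nlinarith
  have hrate : β * ((N : ℝ) ^ 2 * (18 * (2 * |t| + |U|) + 36 * |t'|)) / ((k : ℝ) + 1) ≤
      2 * β * (18 * (2 * |t| + |U|) + 36 * |t'|) / x := by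
    rw [div_le_div_iff₀ hk1 hx0]
    have h1 : (N : ℝ) ^ 2 * x ≤ 2 * ((k : ℝ) + 1) := by nlinarith
    have := mul_le_mul_of_nonneg_left h1 (mul_nonneg hβ hr0)
    nlinarith [this]
  have e : 4 * β * (18 * (2 * |t| + |U|) + 36 * |t'|) / x = 2 * (2 * β * (18 * (2 * |t| + |U|) + 36 * |t'|) / x) := by
    ring
  rw [e]
  linarith

/-- **`d` pairs below density `y`** (telescoped `log_partitionFn_pair_step_ge`): for `S + d = k_* ≤ yN²/2`,
`d · (2 log((2−y)/y) − 4βr/(2−y)) ≤ log Z(k_*,k_*) − log Z(S,S)`. [cite: Ruelle1969, §3.4] -/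
theorem log_partitionFn_pairs_ge {y : ℝ} (hy2 : y < 2) {N : ℕ} (hN : 1 ≤ N) {kz : ℕ}
    (hkz : (kz : ℝ) ≤ y / 2 * (N : ℝ) ^ 2) :
    ∀ (d S : ℕ), S + d = kz →
      (d : ℝ) * (2 * Real.log ((2 - y) / y) - 4 * β * (18 * (2 * |t| + |U|) + 36 * |t'|) / (2 - y)) ≤
        Real.log (partitionFn β (spinSectorHamiltonian kz kz (hubbardRectTorusTT' N N t t' U))).re -
          Real.log (partitionFn β (spinSectorHamiltonian S S (hubbardRectTorusTT' N N t t' U))).re := by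
  intro d
  induction d with
  | zero =>
      intro S hS
      rw [add_zero] at hS
      subst hS
      simp
  | succ d ih =>
      intro S hS
      have h1 := ih (S + 1) (by omega)
      have h2 := log_partitionFn_pair_step_ge t t' U hβ hy2 hN (k := S) (kz := kz) (by omega) hkz
      push_cast
      linarith

/-- **`d` pairs above density `x`** (telescoped `log_partitionFn_pair_step_le`): for `xN²/2 < S + 1` and
`S + d ≤ N²`, `log Z(S+d,S+d) − log Z(S,S) ≤ d · (2 log(2/x) + 4βr/x)`. [cite: Ruelle1969, §3.4] -/
theorem log_partitionFn_pairs_le {x : ℝ} (hx0 : 0 < x) {N : ℕ} :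
    ∀ (d S : ℕ), x / 2 * (N : ℝ) ^ 2 < (S : ℝ) + 1 → S + d ≤ N * N →
      Real.log (partitionFn β (spinSectorHamiltonian (S + d) (S + d) (hubbardRectTorusTT' N N t t' U))).re -
          Real.log (partitionFn β (spinSectorHamiltonian S S (hubbardRectTorusTT' N N t t' U))).re ≤
        (d : ℝ) * (2 * Real.log (2 / x) + 4 * β * (18 * (2 * |t| + |U|) + 36 * |t'|) / x) := by
  intro d
  induction d with
  | zero =>
      intro S _ _
      simp
  | succ d ih =>
      intro S hS hSd
      have h1 := ih (S + 1) (by push_cast; linarith) (by omega)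
      have h2 := log_partitionFn_pair_step_le t t' U hβ hx0 (N := N) (k := S) hS (by omega)
      have e : S + 1 + d = S + (d + 1) := by ring
      rw [e] at h1
      push_cast
      linarith

/-- **Finite-volume density bounds for the sector pressure** (`L ≥ 1`, `0 ≤ x ≤ y < 2`, `0 < y`):
`(y − x)/2 · C⁻(y) − |C⁻(y)|/L² ≤ p_L(y) − p_L(x)`, `C⁻(y) = 2 log((2−y)/y) − 4βr/(2−y)`. [cite: Ruelle1969, §3.4] -/
theorem sectorPressureTT'_sub_ge_density {x y : ℝ} (hx0 : 0 ≤ x) (hxy : x ≤ y) (hy2 : y < 2) {L : ℕ}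
    (hL : 1 ≤ L) :
    (y - x) / 2 * (2 * Real.log ((2 - y) / y) - 4 * β * (18 * (2 * |t| + |U|) + 36 * |t'|) / (2 - y)) -
        |2 * Real.log ((2 - y) / y) - 4 * β * (18 * (2 * |t| + |U|) + 36 * |t'|) / (2 - y)| / (L : ℝ) ^ 2 ≤
      sectorPressureTT' β t t' U y L - sectorPressureTT' β t t' U x L := by
  set C := 2 * Real.log ((2 - y) / y) - 4 * β * (18 * (2 * |t| + |U|) + 36 * |t'|) / (2 - y) with hC
  have hL2 : (0 : ℝ) < (L : ℝ) ^ 2 := by positivity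
  have hk12 : halfRectN x L ≤ halfRectN y L := halfRectN_mono hxy L
  obtain ⟨d, hd⟩ : ∃ d, halfRectN y L = halfRectN x L + d := ⟨_, (Nat.add_sub_cancel' hk12).symm⟩
  have hkz : (halfRectN y L : ℝ) ≤ y / 2 * (L : ℝ) ^ 2 := halfRectN_real_le (hx0.trans hxy) L
  have htel := log_partitionFn_pairs_ge t t' U hβ hy2 hL hkz d (halfRectN x L) hd.symm
  rw [← hC] at htel
  -- `|d − (y−x)L²/2| ≤ 1`
  have hdR : (d : ℝ) = (halfRectN y L : ℝ) - halfRectN x L := by rw [hd]; push_cast; ring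
  have h1 := halfRectN_real_le hx0 L
  have h2 := halfRectN_real_gt x L
  have h3 := halfRectN_real_gt y L
  have hdev : |(d : ℝ) - (y - x) / 2 * (L : ℝ) ^ 2| ≤ 1 := by
    rw [abs_le, hdR]; constructor <;> nlinarith
  have hprod : (y - x) / 2 * (L : ℝ) ^ 2 * C - |C| ≤ (d : ℝ) * C := by
    have e : (d : ℝ) * C - (y - x) / 2 * (L : ℝ) ^ 2 * C = ((d : ℝ) - (y - x) / 2 * (L : ℝ) ^ 2) * C := by ring
    have hle : |((d : ℝ) - (y - x) / 2 * (L : ℝ) ^ 2) * C| ≤ |C| := by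
      rw [abs_mul]
      calc _ ≤ 1 * |C| := mul_le_mul_of_nonneg_right hdev (abs_nonneg C)
        _ = |C| := one_mul _
    have := neg_abs_le (((d : ℝ) - (y - x) / 2 * (L : ℝ) ^ 2) * C)
    linarith
  -- the sector pressures
  unfold sectorPressureTT'
  rw [log_partitionFn_sectorHamiltonianTT'_eq_rect, log_partitionFn_sectorHamiltonianTT'_eq_rect, ← sub_div,
    le_div_iff₀ hL2]
  have e : ((y - x) / 2 * C - |C| / (L : ℝ) ^ 2) * (L : ℝ) ^ 2 = (y - x) / 2 * (L : ℝ) ^ 2 * C - |C| := by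
    field_simp
  rw [e]
  exact hprod.trans htel

/-- **Finite-volume density bounds for the sector pressure** (`L ≥ 1`, `0 < x ≤ y < 2`):
`p_L(y) − p_L(x) ≤ (y − x)/2 · C⁺(x) + C⁺(x)/L²`, `C⁺(x) = 2 log(2/x) + 4βr/x ≥ 0`. [cite: Ruelle1969, §3.4] -/
theorem sectorPressureTT'_sub_le_density {x y : ℝ} (hx0 : 0 < x) (hxy : x ≤ y) (hy2 : y < 2) {L : ℕ}
    (hL : 1 ≤ L) :
    sectorPressureTT' β t t' U y L - sectorPressureTT' β t t' U x L ≤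
      (y - x) / 2 * (2 * Real.log (2 / x) + 4 * β * (18 * (2 * |t| + |U|) + 36 * |t'|) / x) +
        (2 * Real.log (2 / x) + 4 * β * (18 * (2 * |t| + |U|) + 36 * |t'|) / x) / (L : ℝ) ^ 2 := by
  set C := 2 * Real.log (2 / x) + 4 * β * (18 * (2 * |t| + |U|) + 36 * |t'|) / x with hC
  have hC0 : 0 ≤ C := by
    rw [hC]
    have : 0 ≤ Real.log (2 / x) := Real.log_nonneg (by rw [le_div_iff₀ hx0]; linarith)
    have hr0 : 0 ≤ 18 * (2 * |t| + |U|) + 36 * |t'| := by positivity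
    positivity
  have hL2 : (0 : ℝ) < (L : ℝ) ^ 2 := by positivity
  have hk12 : halfRectN x L ≤ halfRectN y L := halfRectN_mono hxy L
  obtain ⟨d, hd⟩ : ∃ d, halfRectN y L = halfRectN x L + d := ⟨_, (Nat.add_sub_cancel' hk12).symm⟩
  have hS : x / 2 * (L : ℝ) ^ 2 < (halfRectN x L : ℝ) + 1 := by
    have := halfRectN_real_gt x L; linarith
  have htop : halfRectN x L + d ≤ L * L := by rw [← hd]; exact (halfRectN_lt_sq (hx0.le.trans hxy) hy2 hL).le
  have htel := log_partitionFn_pairs_le t t' U hβ hx0 d (halfRectN x L) hS htop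
  rw [← hd, ← hC] at htel
  have hdR : (d : ℝ) = (halfRectN y L : ℝ) - halfRectN x L := by rw [hd]; push_cast; ring
  have h2 := halfRectN_real_gt x L
  have h3 := halfRectN_real_le (hx0.le.trans hxy) L
  have hdle : (d : ℝ) ≤ (y - x) / 2 * (L : ℝ) ^ 2 + 1 := by rw [hdR]; nlinarith
  have hprod : (d : ℝ) * C ≤ ((y - x) / 2 * (L : ℝ) ^ 2 + 1) * C := mul_le_mul_of_nonneg_right hdle hC0
  unfold sectorPressureTT'
  rw [log_partitionFn_sectorHamiltonianTT'_eq_rect, log_partitionFn_sectorHamiltonianTT'_eq_rect, ← sub_div,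
    div_le_iff₀ hL2]
  have e : ((y - x) / 2 * C + C / (L : ℝ) ^ 2) * (L : ℝ) ^ 2 = ((y - x) / 2 * (L : ℝ) ^ 2 + 1) * C := by
    field_simp
  rw [e]
  exact htel.trans hprod

end Finite

/-! ### §2 The number `p(β; t,t',U; n)` is locally Lipschitz in the density -/

section Lipschitz

variable {β : ℝ} (hβ : 0 ≤ β) (t t' : ℝ) {U : ℝ} (hU : 0 ≤ U)
include hβ hU

/-- **Adding density, lower bound** (`0 ≤ x ≤ y < 2`, `0 < y`):
`(y − x)(log((2−y)/y) − 2βr/(2−y)) ≤ p(y) − p(x)`, `r = 18(2|t|+|U|) + 36|t'|` — adding electrons raises the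
pressure by at least the ideal lattice-gas entropy at the upper density minus `O(β)`. [cite: Ruelle1969, §3.4] -/
theorem density_mul_le_pressureTT'_sub {x y : ℝ} (hx0 : 0 ≤ x) (hxy : x ≤ y) (hy2 : y < 2) :
    (y - x) * (Real.log ((2 - y) / y) - 2 * β * (18 * (2 * |t| + |U|) + 36 * |t'|) / (2 - y)) ≤
      pressureTT' β t t' U y - pressureTT' β t t' U x := by
  set C := 2 * Real.log ((2 - y) / y) - 4 * β * (18 * (2 * |t| + |U|) + 36 * |t'|) / (2 - y) with hC
  have hlim := (tendsto_sectorPressureTT' hβ t t' hU (hx0.trans hxy) hy2).sub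
    (tendsto_sectorPressureTT' hβ t t' hU hx0 (lt_of_le_of_lt hxy hy2))
  have hg : Tendsto (fun L : ℕ => (y - x) / 2 * C - |C| / (L : ℝ) ^ 2) atTop (𝓝 ((y - x) / 2 * C - 0)) := by
    refine tendsto_const_nhds.sub ?_
    have h := (tendsto_const_div_atTop_nhds_zero_nat |C|).comp (tendsto_pow_atTop (n := 2) two_ne_zero)
    refine h.congr fun L => ?_
    simp
  rw [sub_zero] at hg
  have hle := le_of_tendsto_of_tendsto hg hlim (eventually_atTop.2 ⟨1, fun L hL =>
    sectorPressureTT'_sub_ge_density t t' U hβ hx0 hxy hy2 hL⟩)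
  have e : (y - x) * (Real.log ((2 - y) / y) - 2 * β * (18 * (2 * |t| + |U|) + 36 * |t'|) / (2 - y)) =
      (y - x) / 2 * C := by rw [hC]; ring
  rw [e]
  exact hle

/-- **Adding density, upper bound** (`0 < x ≤ y < 2`): `p(y) − p(x) ≤ (y − x)(log(2/x) + 2βr/x)`.
[cite: Ruelle1969, §3.4] -/
theorem pressureTT'_sub_le_density_mul {x y : ℝ} (hx0 : 0 < x) (hxy : x ≤ y) (hy2 : y < 2) :
    pressureTT' β t t' U y - pressureTT' β t t' U x ≤
      (y - x) * (Real.log (2 / x) + 2 * β * (18 * (2 * |t| + |U|) + 36 * |t'|) / x) := by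
  set C := 2 * Real.log (2 / x) + 4 * β * (18 * (2 * |t| + |U|) + 36 * |t'|) / x with hC
  have hlim := (tendsto_sectorPressureTT' hβ t t' hU (hx0.le.trans hxy) hy2).sub
    (tendsto_sectorPressureTT' hβ t t' hU hx0.le (lt_of_le_of_lt hxy hy2))
  have hg : Tendsto (fun L : ℕ => (y - x) / 2 * C + C / (L : ℝ) ^ 2) atTop (𝓝 ((y - x) / 2 * C + 0)) := by
    refine tendsto_const_nhds.add ?_
    have h := (tendsto_const_div_atTop_nhds_zero_nat C).comp (tendsto_pow_atTop (n := 2) two_ne_zero)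
    refine h.congr fun L => ?_
    simp
  rw [add_zero] at hg
  have hle := le_of_tendsto_of_tendsto hlim hg (eventually_atTop.2 ⟨1, fun L hL =>
    sectorPressureTT'_sub_le_density t t' U hβ hx0 hxy hy2 hL⟩)
  have e : (y - x) * (Real.log (2 / x) + 2 * β * (18 * (2 * |t| + |U|) + 36 * |t'|) / x) = (y - x) / 2 * C := by
    rw [hC]; ring
  rw [e]
  exact hle

/-- **Local Lipschitz continuity of the thermal pressure in the density.** On a density window
`[lo, hi] ⊂ (0, 2)`: `|p(y) − p(x)| ≤ |y − x| · (log(2/lo) + log(2/(2−hi)) + 2βr(1/lo + 1/(2−hi)))` for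
`x, y ∈ [lo, hi]`, `r = 18(2|t|+|U|) + 36|t'|`. [cite: Ruelle1969, §3.4] -/
theorem abs_pressureTT'_sub_le_density {lo hi x y : ℝ} (hlo : 0 < lo) (hhi : hi < 2) (hx : lo ≤ x) (hxh : x ≤ hi)
    (hy : lo ≤ y) (hyh : y ≤ hi) :
    |pressureTT' β t t' U y - pressureTT' β t t' U x| ≤
      |y - x| * (Real.log (2 / lo) + Real.log (2 / (2 - hi)) +
        2 * β * (18 * (2 * |t| + |U|) + 36 * |t'|) * (1 / lo + 1 / (2 - hi))) := by
  have hr0 : 0 ≤ 18 * (2 * |t| + |U|) + 36 * |t'| := by positivity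
  have hlo2 : 0 ≤ Real.log (2 / lo) := Real.log_nonneg (by rw [le_div_iff₀ hlo]; linarith)
  have h2hi : 0 < 2 - hi := by linarith
  have hhi2 : 0 ≤ Real.log (2 / (2 - hi)) := Real.log_nonneg (by rw [le_div_iff₀ h2hi]; linarith)
  wlog hxy : x ≤ y generalizing x y
  · have h := this hy hyh hx hxh (le_of_not_ge hxy)
    rw [abs_sub_comm] at h
    rw [abs_sub_comm x y] at h
    exact h
  rw [abs_of_nonneg (sub_nonneg.2 hxy)]
  have hx0 : 0 < x := hlo.trans_le hx
  have hy2 : y < 2 := lt_of_le_of_lt hyh hhi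
  have hup := pressureTT'_sub_le_density_mul hβ t t' hU hx0 hxy hy2
  have hlow := density_mul_le_pressureTT'_sub hβ t t' hU hx0.le hxy hy2
  set r := 18 * (2 * |t| + |U|) + 36 * |t'| with hr
  -- compare the density-dependent constants with the window constants
  have c1 : Real.log (2 / x) ≤ Real.log (2 / lo) :=
    Real.log_le_log (by positivity) (div_le_div_of_nonneg_left (by norm_num) hlo hx)
  have eR : 2 * β * r * (1 / lo + 1 / (2 - hi)) = 2 * β * r / lo + 2 * β * r / (2 - hi) := by ring
  have c2 : 2 * β * r / x ≤ 2 * β * r * (1 / lo + 1 / (2 - hi)) := by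
    rw [eR]
    have h1 : 2 * β * r / x ≤ 2 * β * r / lo := div_le_div_of_nonneg_left (by positivity) hlo hx
    have h2 : 0 ≤ 2 * β * r / (2 - hi) := by positivity
    linarith
  have hy0 : 0 < y := hx0.trans_le hxy
  have c3 : -Real.log ((2 - y) / y) ≤ Real.log (2 / (2 - hi)) := by
    rw [← Real.log_inv, inv_div]
    refine Real.log_le_log (div_pos hy0 (by linarith)) ?_
    rw [div_le_div_iff₀ (by linarith) h2hi]
    nlinarith
  have c4 : 2 * β * r / (2 - y) ≤ 2 * β * r * (1 / lo + 1 / (2 - hi)) := by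
    rw [eR]
    have h1 : 2 * β * r / (2 - y) ≤ 2 * β * r / (2 - hi) :=
      div_le_div_of_nonneg_left (by positivity) h2hi (by linarith)
    have h2 : 0 ≤ 2 * β * r / lo := by positivity
    linarith
  rw [abs_le]
  constructor
  · -- lower: `p y − p x ≥ (y−x)(log((2−y)/y) − 2βr/(2−y)) ≥ −(y−x)·C`
    have : (y - x) * (-(Real.log (2 / lo) + Real.log (2 / (2 - hi)) + 2 * β * r * (1 / lo + 1 / (2 - hi)))) ≤
        (y - x) * (Real.log ((2 - y) / y) - 2 * β * r / (2 - y)) :=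
      mul_le_mul_of_nonneg_left (by linarith) (sub_nonneg.2 hxy)
    linarith
  · have : (y - x) * (Real.log (2 / x) + 2 * β * r / x) ≤
        (y - x) * (Real.log (2 / lo) + Real.log (2 / (2 - hi)) + 2 * β * r * (1 / lo + 1 / (2 - hi))) :=
      mul_le_mul_of_nonneg_left (by linarith) (sub_nonneg.2 hxy)
    linarith

/-- **Lipschitz on density windows**: on `[lo, hi] ⊂ (0, 2)` the pressure `n ↦ p(β; t,t',U; n)` is Lipschitz with
constant `log(2/lo) + log(2/(2−hi)) + 2βr(1/lo + 1/(2−hi))`. [cite: Ruelle1969, §3.4] -/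
theorem lipschitzOnWith_pressureTT'_density {lo hi : ℝ} (hlo : 0 < lo) (hhi : hi < 2) :
    LipschitzOnWith (Real.toNNReal (Real.log (2 / lo) + Real.log (2 / (2 - hi)) +
        2 * β * (18 * (2 * |t| + |U|) + 36 * |t'|) * (1 / lo + 1 / (2 - hi))))
      (pressureTT' β t t' U) (Set.Icc lo hi) := by
  refine LipschitzOnWith.of_dist_le' fun x hx y hy => ?_
  rw [Real.dist_eq, Real.dist_eq, mul_comm]
  exact abs_pressureTT'_sub_le_density hβ t t' hU hlo hhi hy.1 hy.2 hx.1 hx.2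

/-- **Continuity of the pressure in the density** on the open density interval `(0, 2)`. [cite: Ruelle1969, §3.4] -/
theorem continuousOn_pressureTT'_density : ContinuousOn (pressureTT' β t t' U) (Set.Ioo 0 2) := by
  intro n hn
  obtain ⟨hn0, hn2⟩ := hn
  have hlo : 0 < n / 2 := by linarith
  have hhi : (n + 2) / 2 < 2 := by linarith
  have hL := (lipschitzOnWith_pressureTT'_density hβ t t' hU hlo hhi).continuousOn
  have hmem : Set.Icc (n / 2) ((n + 2) / 2) ∈ 𝓝 n := Icc_mem_nhds (by linarith) (by linarith)
  exact (hL.continuousAt hmem).continuousWithinAt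

end Lipschitz

/-! ### §3 Concavity at rational weights: Ruelle's mixed tiling -/

section Rational

/-- Row sums: `Σ_{i < K} (if i < a then X else Y) = a X + (K - a) Y` for `a ≤ K`. [folklore] -/
private theorem sum_fin_ite_lt_of_le {γ : Type*} [AddCommMonoid γ] (K a : ℕ) (ha : a ≤ K) (X Y : γ) :
    ∑ i : Fin K, (if (i : ℕ) < a then X else Y) = a • X + (K - a) • Y := by
  rw [Fin.sum_univ_eq_sum_range (f := fun i => if i < a then X else Y), Finset.range_eq_Ico,
    ← Finset.sum_Ico_consecutive _ (Nat.zero_le a) ha]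
  congr 1
  · rw [Finset.sum_congr rfl (fun i hi => if_pos (Finset.mem_Ico.1 hi).2), Finset.sum_const,
      Nat.card_Ico, Nat.sub_zero]
  · rw [Finset.sum_congr rfl (fun i hi => if_neg (not_lt.2 (Finset.mem_Ico.1 hi).1)),
      Finset.sum_const, Nat.card_Ico]

variable (t t' U : ℝ) {β : ℝ} (hβ : 0 ≤ β)
include hβ

/-- **The mixed-tiling inequality at finite size.** For densities `x, y ∈ [0,2)`, `K = k+1`, `a ≤ K`, tile the
`KM × KM` torus (`M ≥ 1`) by `K²` blocks of side `M`, `aK` of them in the sector `k_M(x)` and the rest in `k_M(y)`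
(`prod_partitionFn_hubbardRectTorusTT'_squares_le`, seam price `β(16|t|+32|t'|) M k(k+1)`), and add the `< K²`
rounding pairs up to `k_{KM}(z)`, `z = (a x + (K−a) y)/K`, at the price of §1:
`(a/K) p_M(x) + ((K−a)/K) p_M(y) − (β(16|t|+32|t'|) + K² |2 log((2−z)/z) − 4βr/(2−z)|)/M ≤ p_{KM}(z)`.
[cite: Ruelle1969, §3.4] -/
theorem sectorPressureTT'_rows_le {x y : ℝ} (hx0 : 0 ≤ x) (hx2 : x < 2) (hy0 : 0 ≤ y) (hy2 : y < 2) (k a : ℕ)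
    (ha : a ≤ k + 1) {M : ℕ} (hM : 1 ≤ M) :
    (a / (k + 1 : ℕ)) * sectorPressureTT' β t t' U x M +
        (((k + 1 : ℕ) - a) / (k + 1 : ℕ)) * sectorPressureTT' β t t' U y M -
        (β * (16 * |t| + 32 * |t'|) + ((k + 1 : ℕ) : ℝ) ^ 2 *
          |2 * Real.log ((2 - (a * x + ((k + 1 : ℕ) - a) * y) / (k + 1 : ℕ)) /
              ((a * x + ((k + 1 : ℕ) - a) * y) / (k + 1 : ℕ))) -
            4 * β * (18 * (2 * |t| + |U|) + 36 * |t'|) / (2 - (a * x + ((k + 1 : ℕ) - a) * y) / (k + 1 : ℕ))|) / M ≤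
      sectorPressureTT' β t t' U ((a * x + ((k + 1 : ℕ) - a) * y) / (k + 1 : ℕ)) ((k + 1) * M) := by
  -- abbreviations (opaque names for the natural-number data: no `set` on sector indices)
  have hKpos : (0 : ℝ) < (k + 1 : ℕ) := by positivity
  have haK : (a : ℝ) ≤ (k + 1 : ℕ) := by exact_mod_cast ha
  have hKa : (0 : ℝ) ≤ ((k + 1 : ℕ) : ℝ) - a := by linarith
  have ha0 : (0 : ℝ) ≤ a := Nat.cast_nonneg a
  have hMpos : (0 : ℝ) < M := by exact_mod_cast hM
  have hM1 : (1 : ℝ) ≤ M := by exact_mod_cast hM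
  set z : ℝ := (a * x + ((k + 1 : ℕ) - a) * y) / (k + 1 : ℕ) with hz
  clear_value z
  set C : ℝ := 2 * Real.log ((2 - z) / z) - 4 * β * (18 * (2 * |t| + |U|) + 36 * |t'|) / (2 - z) with hC
  clear_value C
  have hc0 : (0 : ℝ) ≤ 16 * |t| + 32 * |t'| := by positivity
  -- the density `z ∈ [0, 2)`
  have hz0 : 0 ≤ z := by
    rw [hz]; apply div_nonneg _ hKpos.le
    have : 0 ≤ (((k + 1 : ℕ) : ℝ) - a) * y := mul_nonneg hKa hy0
    positivity
  have hz2 : z < 2 := by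
    rw [hz, div_lt_iff₀ hKpos]
    have h1 : (a : ℝ) * x ≤ a * max x y := mul_le_mul_of_nonneg_left (le_max_left _ _) ha0
    have h2 : (((k + 1 : ℕ) : ℝ) - a) * y ≤ (((k + 1 : ℕ) : ℝ) - a) * max x y :=
      mul_le_mul_of_nonneg_left (le_max_right _ _) hKa
    have : max x y < 2 := max_lt hx2 hy2
    nlinarith
  -- block sectors
  obtain ⟨kx, hkx⟩ : ∃ kx : ℕ, halfRectN x M = kx := ⟨_, rfl⟩
  obtain ⟨ky, hky⟩ : ∃ ky : ℕ, halfRectN y M = ky := ⟨_, rfl⟩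
  obtain ⟨kz, hkz⟩ : ∃ kz : ℕ, halfRectN z ((k + 1) * M) = kz := ⟨_, rfl⟩
  have hkxM : kx < M * M := by rw [← hkx]; exact halfRectN_lt_sq hx0 hx2 hM
  have hkyM : ky < M * M := by rw [← hky]; exact halfRectN_lt_sq hy0 hy2 hM
  have hkx_le : (kx : ℝ) ≤ x / 2 * (M : ℝ) ^ 2 := by rw [← hkx]; exact halfRectN_real_le hx0 M
  have hky_le : (ky : ℝ) ≤ y / 2 * (M : ℝ) ^ 2 := by rw [← hky]; exact halfRectN_real_le hy0 M
  have hkx_gt : x / 2 * (M : ℝ) ^ 2 - 1 < kx := by rw [← hkx]; exact halfRectN_real_gt x M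
  have hky_gt : y / 2 * (M : ℝ) ^ 2 - 1 < ky := by rw [← hky]; exact halfRectN_real_gt y M
  have hkz_le : (kz : ℝ) ≤ z / 2 * ((((k + 1) * M : ℕ) : ℝ)) ^ 2 := by rw [← hkz]; exact halfRectN_real_le hz0 _
  obtain ⟨ps, hps⟩ : ∃ ps : Fin (k + 1) → Fin (k + 1) → ℕ,
      ps = fun (i : Fin (k + 1)) (_ : Fin (k + 1)) => if (i : ℕ) < a then kx else ky := ⟨_, rfl⟩
  have hps_apply : ∀ i j, ps i j = if (i : ℕ) < a then kx else ky := fun i j => by rw [hps]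
  have hps_le : ∀ i j, ps i j ≤ M * M := by
    intro i j; rw [hps_apply]; split_ifs
    · exact hkxM.le
    · exact hkyM.le
  have hsumN : ∑ i : Fin (k + 1), ∑ j : Fin (k + 1), ps i j = (k + 1) * (a * kx + (k + 1 - a) * ky) := by
    simp only [hps_apply, Finset.sum_const, Finset.card_univ, Fintype.card_fin, smul_eq_mul]
    rw [← Finset.mul_sum, sum_fin_ite_lt_of_le (k + 1) a ha, smul_eq_mul, smul_eq_mul]
  obtain ⟨S, hS⟩ : ∃ S : ℕ, (k + 1) * (a * kx + (k + 1 - a) * ky) = S := ⟨_, rfl⟩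
  -- positivity of the partition functions involved
  have hHM := hubbardRectTorusTT'_isHermitian M M t t' U
  have hZpos : ∀ q : ℕ, q ≤ M * M →
      0 < (partitionFn β (spinSectorHamiltonian q q (hubbardRectTorusTT' M M t t' U))).re := by
    intro q hq
    have hq' : q ≤ Fintype.card (Fin M ×ₗ Fin M) := by rw [card_rectSites]; exact hq
    haveI := nonempty_spinConfig (Λ := Fin M ×ₗ Fin M) hq' hq'
    exact partitionFn_spinSector_re_pos hHM β
  -- the tiling inequality and its logarithm
  have htile := prod_partitionFn_hubbardRectTorusTT'_squares_le M t t' U hβ k ps ps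
  rw [hsumN, hS] at htile
  have hprodpos : 0 < ∏ i : Fin (k + 1), ∏ j : Fin (k + 1),
      (partitionFn β (spinSectorHamiltonian (ps i j) (ps i j) (hubbardRectTorusTT' M M t t' U))).re :=
    Finset.prod_pos fun i _ => Finset.prod_pos fun j _ => hZpos _ (hps_le i j)
  have hlogtile : -(β * ((16 * |t| + 32 * |t'|) * M * k * (k + 1))) +
      ∑ i : Fin (k + 1), ∑ j : Fin (k + 1),
        Real.log (partitionFn β (spinSectorHamiltonian (ps i j) (ps i j) (hubbardRectTorusTT' M M t t' U))).re ≤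
      Real.log (partitionFn β (spinSectorHamiltonian S S (hubbardRectTorusTT' ((k + 1) * M) ((k + 1) * M) t t' U))).re := by
    have h := Real.log_le_log (mul_pos (Real.exp_pos _) hprodpos) htile
    rw [Real.log_mul (Real.exp_pos _).ne' hprodpos.ne', Real.log_exp,
      Real.log_prod (fun i _ => (Finset.prod_pos fun j _ => hZpos _ (hps_le i j)).ne')] at h
    have e : ∀ i : Fin (k + 1), Real.log (∏ j : Fin (k + 1),
        (partitionFn β (spinSectorHamiltonian (ps i j) (ps i j) (hubbardRectTorusTT' M M t t' U))).re) =
        ∑ j : Fin (k + 1), Real.log (partitionFn β (spinSectorHamiltonian (ps i j) (ps i j)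
          (hubbardRectTorusTT' M M t t' U))).re :=
      fun i => Real.log_prod (fun j _ => (hZpos _ (hps_le i j)).ne')
    simp only [e] at h
    exact h
  clear htile hprodpos
  have hsumE : ∑ i : Fin (k + 1), ∑ _j : Fin (k + 1),
      Real.log (partitionFn β (spinSectorHamiltonian (ps i _j) (ps i _j) (hubbardRectTorusTT' M M t t' U))).re =
      ((k + 1 : ℕ) : ℝ) * (a * Real.log (partitionFn β (spinSectorHamiltonian kx kx (hubbardRectTorusTT' M M t t' U))).re +
        (((k + 1 : ℕ) : ℝ) - a) *
          Real.log (partitionFn β (spinSectorHamiltonian ky ky (hubbardRectTorusTT' M M t t' U))).re) := by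
    have e2 : ∀ i j : Fin (k + 1), Real.log (partitionFn β (spinSectorHamiltonian (ps i j) (ps i j)
        (hubbardRectTorusTT' M M t t' U))).re =
        if (i : ℕ) < a then Real.log (partitionFn β (spinSectorHamiltonian kx kx (hubbardRectTorusTT' M M t t' U))).re
        else Real.log (partitionFn β (spinSectorHamiltonian ky ky (hubbardRectTorusTT' M M t t' U))).re := fun i j => by
      by_cases hi : (i : ℕ) < a
      · rw [if_pos hi, hps_apply, if_pos hi]
      · rw [if_neg hi, hps_apply, if_neg hi]
    simp only [e2, Finset.sum_const, Finset.card_univ, Fintype.card_fin, nsmul_eq_mul]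
    rw [← Finset.mul_sum, sum_fin_ite_lt_of_le (k + 1) a ha, nsmul_eq_mul, nsmul_eq_mul, Nat.cast_sub ha]
  rw [hsumE] at hlogtile
  -- the rounding pairs `S ≤ k_{KM}(z) < S + K²`
  have hzKM : z / 2 * ((((k + 1) * M : ℕ) : ℝ)) ^ 2 =
      (k + 1 : ℕ) * (a * (x / 2 * (M : ℝ) ^ 2) + (((k + 1 : ℕ) : ℝ) - a) * (y / 2 * (M : ℝ) ^ 2)) := by
    rw [hz]; push_cast; field_simp
  have hSR : ((S : ℕ) : ℝ) = (k + 1 : ℕ) * (a * (kx : ℝ) + (((k + 1 : ℕ) : ℝ) - a) * ky) := by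
    rw [← hS]; push_cast [Nat.cast_sub ha]; ring
  have hSle_kz : S ≤ kz := by
    rw [← hkz, halfRectN]
    refine Nat.le_floor ?_
    have e1 : z * ((((k + 1) * M : ℕ) : ℝ)) ^ 2 / 2 = z / 2 * ((((k + 1) * M : ℕ) : ℝ)) ^ 2 := by ring
    rw [e1, hzKM, hSR]
    refine mul_le_mul_of_nonneg_left ?_ hKpos.le
    exact add_le_add (mul_le_mul_of_nonneg_left hkx_le ha0) (mul_le_mul_of_nonneg_left hky_le hKa)
  obtain ⟨d, hd⟩ : ∃ d, kz = S + d := ⟨_, (Nat.add_sub_cancel' hSle_kz).symm⟩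
  have hdle : (d : ℝ) ≤ ((k + 1 : ℕ) : ℝ) ^ 2 := by
    have h1 : (kz : ℝ) = S + d := by rw [hd]; push_cast; ring
    rw [hzKM] at hkz_le
    rw [hSR] at h1
    have i1 : ((k + 1 : ℕ) : ℝ) * (a * (x / 2 * (M : ℝ) ^ 2 - 1)) ≤ ((k + 1 : ℕ) : ℝ) * (a * kx) :=
      mul_le_mul_of_nonneg_left (mul_le_mul_of_nonneg_left hkx_gt.le ha0) hKpos.le
    have i2 : ((k + 1 : ℕ) : ℝ) * ((((k + 1 : ℕ) : ℝ) - a) * (y / 2 * (M : ℝ) ^ 2 - 1)) ≤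
        ((k + 1 : ℕ) : ℝ) * ((((k + 1 : ℕ) : ℝ) - a) * ky) :=
      mul_le_mul_of_nonneg_left (mul_le_mul_of_nonneg_left hky_gt.le hKa) hKpos.le
    linarith only [i1, i2, hkz_le, h1]
  -- the rounding price
  have hKM1 : 1 ≤ (k + 1) * M := Nat.mul_pos (Nat.succ_pos k) hM
  have hkz_le' : (kz : ℝ) ≤ z / 2 * ((((k + 1) * M : ℕ) : ℝ)) ^ 2 := by rw [← hkz]; exact halfRectN_real_le hz0 _
  have hround := log_partitionFn_pairs_ge t t' U hβ hz2 (N := (k + 1) * M) hKM1 (kz := kz) hkz_le' d S hd.symm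
  rw [← hC] at hround
  have hroundR : -(((k + 1 : ℕ) : ℝ) ^ 2 * |C|) ≤ (d : ℝ) * C := by
    have h1 : -((d : ℝ) * |C|) ≤ (d : ℝ) * C := by
      rw [← mul_neg]; exact mul_le_mul_of_nonneg_left (neg_abs_le C) (Nat.cast_nonneg d)
    have h2 : (d : ℝ) * |C| ≤ ((k + 1 : ℕ) : ℝ) ^ 2 * |C| := mul_le_mul_of_nonneg_right hdle (abs_nonneg C)
    linarith only [h1, h2]
  -- assemble and divide by `(KM)²`
  have hKM2 : (0 : ℝ) < ((((k + 1) * M : ℕ) : ℝ)) ^ 2 := by positivity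
  unfold sectorPressureTT'
  rw [log_partitionFn_sectorHamiltonianTT'_eq_rect, log_partitionFn_sectorHamiltonianTT'_eq_rect,
    log_partitionFn_sectorHamiltonianTT'_eq_rect, hkx, hky, hkz, le_div_iff₀ hKM2]
  have hkK : (k : ℝ) * ((k : ℝ) + 1) ≤ ((k + 1 : ℕ) : ℝ) ^ 2 := by
    push_cast; linarith only [Nat.cast_nonneg (α := ℝ) k]
  have e : ((a : ℝ) / (k + 1 : ℕ) * (Real.log (partitionFn β (spinSectorHamiltonian kx kx
        (hubbardRectTorusTT' M M t t' U))).re / (M : ℝ) ^ 2) +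
      (((k + 1 : ℕ) : ℝ) - a) / (k + 1 : ℕ) * (Real.log (partitionFn β (spinSectorHamiltonian ky ky
        (hubbardRectTorusTT' M M t t' U))).re / (M : ℝ) ^ 2) -
      (β * (16 * |t| + 32 * |t'|) + ((k + 1 : ℕ) : ℝ) ^ 2 * |C|) / M) * ((((k + 1) * M : ℕ) : ℝ)) ^ 2 =
      (k + 1 : ℕ) * (a * Real.log (partitionFn β (spinSectorHamiltonian kx kx (hubbardRectTorusTT' M M t t' U))).re +
        (((k + 1 : ℕ) : ℝ) - a) * Real.log (partitionFn β (spinSectorHamiltonian ky ky (hubbardRectTorusTT' M M t t' U))).re) -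
      (β * (16 * |t| + 32 * |t'|) + ((k + 1 : ℕ) : ℝ) ^ 2 * |C|) * ((k + 1 : ℕ) : ℝ) ^ 2 * M := by
    push_cast; field_simp
  rw [e]
  -- the error budget: `βcMk(k+1) + K²|C| ≤ (βc + K²|C|) K² M`
  have hE1 : β * ((16 * |t| + 32 * |t'|) * M * k * (k + 1)) ≤ β * (16 * |t| + 32 * |t'|) * ((k + 1 : ℕ) : ℝ) ^ 2 * M := by
    have e3 : β * ((16 * |t| + 32 * |t'|) * M * k * (k + 1)) =
        β * (16 * |t| + 32 * |t'|) * ((k : ℝ) * ((k : ℝ) + 1)) * M := by ring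
    rw [e3]
    have hβc : 0 ≤ β * (16 * |t| + 32 * |t'|) := mul_nonneg hβ hc0
    have h4 := mul_le_mul_of_nonneg_left hkK hβc
    exact mul_le_mul_of_nonneg_right h4 hMpos.le
  have hE2 : ((k + 1 : ℕ) : ℝ) ^ 2 * |C| ≤ ((k + 1 : ℕ) : ℝ) ^ 2 * |C| * ((k + 1 : ℕ) : ℝ) ^ 2 * M := by
    have hK1 : (1 : ℝ) ≤ ((k + 1 : ℕ) : ℝ) := by exact_mod_cast Nat.succ_pos k
    have h1 : (1 : ℝ) ≤ ((k + 1 : ℕ) : ℝ) ^ 2 * M := by nlinarith only [hK1, hM1]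
    have h0 : 0 ≤ ((k + 1 : ℕ) : ℝ) ^ 2 * |C| := by positivity
    calc ((k + 1 : ℕ) : ℝ) ^ 2 * |C| = ((k + 1 : ℕ) : ℝ) ^ 2 * |C| * 1 := (mul_one _).symm
      _ ≤ ((k + 1 : ℕ) : ℝ) ^ 2 * |C| * (((k + 1 : ℕ) : ℝ) ^ 2 * M) := mul_le_mul_of_nonneg_left h1 h0
      _ = ((k + 1 : ℕ) : ℝ) ^ 2 * |C| * ((k + 1 : ℕ) : ℝ) ^ 2 * M := by ring
  have hsplit : Real.log (partitionFn β (spinSectorHamiltonian kz kz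
      (hubbardRectTorusTT' ((k + 1) * M) ((k + 1) * M) t t' U))).re =
      (Real.log (partitionFn β (spinSectorHamiltonian kz kz
        (hubbardRectTorusTT' ((k + 1) * M) ((k + 1) * M) t t' U))).re -
        Real.log (partitionFn β (spinSectorHamiltonian S S
          (hubbardRectTorusTT' ((k + 1) * M) ((k + 1) * M) t t' U))).re) +
      Real.log (partitionFn β (spinSectorHamiltonian S S
        (hubbardRectTorusTT' ((k + 1) * M) ((k + 1) * M) t t' U))).re := by ring
  rw [hsplit]
  have hE : (β * (16 * |t| + 32 * |t'|) + ((k + 1 : ℕ) : ℝ) ^ 2 * |C|) * ((k + 1 : ℕ) : ℝ) ^ 2 * M =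
      β * (16 * |t| + 32 * |t'|) * ((k + 1 : ℕ) : ℝ) ^ 2 * M + ((k + 1 : ℕ) : ℝ) ^ 2 * |C| * ((k + 1 : ℕ) : ℝ) ^ 2 * M := by
    ring
  rw [hE]
  linarith only [hlogtile, hround, hroundR, hE1, hE2]

end Rational

section RationalLimit

variable {β : ℝ} (hβ : 0 ≤ β) (t t' : ℝ) {U : ℝ} (hU : 0 ≤ U)
include hβ hU

/-- **Concavity at rational weights.** For densities `x, y ∈ [0,2)`, `K = k+1` and `a ≤ K`:
`(a/K) p(x) + ((K−a)/K) p(y) ≤ p((a x + (K−a) y)/K)` (the mixed-tiling inequality along `M → ∞`).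
[cite: Ruelle1969, §3.4] -/
theorem pressureTT'_ratConcave {x y : ℝ} (hx0 : 0 ≤ x) (hx2 : x < 2) (hy0 : 0 ≤ y) (hy2 : y < 2) (k a : ℕ)
    (ha : a ≤ k + 1) :
    (a / (k + 1 : ℕ)) * pressureTT' β t t' U x + (((k + 1 : ℕ) - a) / (k + 1 : ℕ)) * pressureTT' β t t' U y ≤
      pressureTT' β t t' U ((a * x + ((k + 1 : ℕ) - a) * y) / (k + 1 : ℕ)) := by
  have hKpos : (0 : ℝ) < (k + 1 : ℕ) := by positivity
  have haK : (a : ℝ) ≤ (k + 1 : ℕ) := by exact_mod_cast ha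
  have hKa : (0 : ℝ) ≤ ((k + 1 : ℕ) : ℝ) - a := by linarith
  have hz0 : 0 ≤ (a * x + ((k + 1 : ℕ) - a) * y) / (k + 1 : ℕ) := by
    apply div_nonneg _ hKpos.le
    have : 0 ≤ (((k + 1 : ℕ) : ℝ) - a) * y := mul_nonneg hKa hy0
    positivity
  have hz2 : (a * x + ((k + 1 : ℕ) - a) * y) / (k + 1 : ℕ) < 2 := by
    rw [div_lt_iff₀ hKpos]
    have h1 : (a : ℝ) * x ≤ a * max x y := mul_le_mul_of_nonneg_left (le_max_left _ _) (by positivity)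
    have h2 : (((k + 1 : ℕ) : ℝ) - a) * y ≤ (((k + 1 : ℕ) : ℝ) - a) * max x y :=
      mul_le_mul_of_nonneg_left (le_max_right _ _) hKa
    have : max x y < 2 := max_lt hx2 hy2
    nlinarith
  set E : ℝ := β * (16 * |t| + 32 * |t'|) + ((k + 1 : ℕ) : ℝ) ^ 2 *
    |2 * Real.log ((2 - (a * x + ((k + 1 : ℕ) - a) * y) / (k + 1 : ℕ)) /
        ((a * x + ((k + 1 : ℕ) - a) * y) / (k + 1 : ℕ))) -
      4 * β * (18 * (2 * |t| + |U|) + 36 * |t'|) / (2 - (a * x + ((k + 1 : ℕ) - a) * y) / (k + 1 : ℕ))| with hE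
  have hf := (tendsto_sectorPressureTT' hβ t t' hU hz0 hz2).comp
    (tendsto_atTop_mono (fun M : ℕ => Nat.le_mul_of_pos_left M (Nat.succ_pos k)) tendsto_id)
  have hg : Tendsto (fun M : ℕ => (a / (k + 1 : ℕ)) * sectorPressureTT' β t t' U x M +
      (((k + 1 : ℕ) - a) / (k + 1 : ℕ)) * sectorPressureTT' β t t' U y M - E / M) atTop
      (𝓝 ((a / (k + 1 : ℕ)) * pressureTT' β t t' U x + (((k + 1 : ℕ) - a) / (k + 1 : ℕ)) * pressureTT' β t t' U y - 0)) :=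
    ((tendsto_const_nhds.mul (tendsto_sectorPressureTT' hβ t t' hU hx0 hx2)).add
      (tendsto_const_nhds.mul (tendsto_sectorPressureTT' hβ t t' hU hy0 hy2))).sub
      (tendsto_const_div_atTop_nhds_zero_nat E)
  rw [sub_zero] at hg
  refine le_of_tendsto_of_tendsto hg hf (eventually_atTop.2 ⟨1, fun M hM => ?_⟩)
  have h := sectorPressureTT'_rows_le t t' U hβ hx0 hx2 hy0 hy2 k a ha hM
  rw [← hE] at h
  exact h

/-! ### §4 Concavity in the density -/

/-- **Concavity of the thermal pressure in the density.** For `β ≥ 0`, `U ≥ 0` the thermodynamic-limit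
pressure `n ↦ p(β; t,t',U; n)` of the 2D `t–t'` Hubbard model is concave on `[0, 2)`: rational weights by the
mixed tiling (`pressureTT'_ratConcave`), real weights by approximating the weight from below and the density
continuity `density_mul_le_pressureTT'_sub` (Ruelle 1969 §3.4: the canonical free energy density is convex in the
density). [cite: Ruelle1969, §3.4] -/
theorem concaveOn_pressureTT'_density :
    ConcaveOn ℝ (Set.Ico (0 : ℝ) 2) (pressureTT' β t t' U) := by
  refine ⟨convex_Ico 0 2, ?_⟩
  intro x hx y hy a b ha hb hab
  wlog hxy : x ≤ y generalizing x y a b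
  · have h := this hy hx hb ha (by linarith) (le_of_not_ge hxy)
    rw [add_comm (b • y) (a • x)] at h
    rw [add_comm (b • pressureTT' β t t' U y)] at h
    exact h
  rw [smul_eq_mul, smul_eq_mul, smul_eq_mul, smul_eq_mul]
  obtain ⟨hx0, hx2⟩ := hx
  obtain ⟨hy0, hy2⟩ := hy
  set w := a * x + b * y with hw
  have hb1 : b ≤ 1 := by linarith
  have hwx : x ≤ w := by simp only [hw]; nlinarith
  have hwy : w ≤ y := by simp only [hw]; nlinarith
  have hw2 : w < 2 := hwy.trans_lt hy2
  have hw0 : 0 ≤ w := hx0.trans hwx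
  set px := pressureTT' β t t' U x
  set py := pressureTT' β t t' U y
  set D : ℝ := Real.log ((2 - w) / w) - 2 * β * (18 * (2 * |t| + |U|) + 36 * |t'|) / (2 - w) with hD
  set C : ℝ := |px| + |py| + |D| * (y - x) with hC
  have hC0 : 0 ≤ C := by simp only [hC]; have := mul_nonneg (abs_nonneg D) (sub_nonneg.2 hxy); positivity
  -- `a p(x) + b p(y) ≤ p(w) + C/(k+1)` for every `k`
  have key : ∀ k : ℕ, a * px + b * py ≤ pressureTT' β t t' U w + C / (k + 1 : ℕ) := by
    intro k
    have hKpos : (0 : ℝ) < (k + 1 : ℕ) := by positivity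
    set m : ℕ := ⌊b * (k + 1 : ℕ)⌋₊ with hm
    have hmle : (m : ℝ) ≤ b * (k + 1 : ℕ) := Nat.floor_le (by positivity)
    have hmlt : b * (k + 1 : ℕ) < m + 1 := Nat.lt_floor_add_one _
    have hmK : m ≤ k + 1 := by
      have : (m : ℝ) ≤ (k + 1 : ℕ) := hmle.trans (by nlinarith)
      exact_mod_cast this
    -- the rational point `z = ((K - m) x + m y)/K ≤ w`
    set z : ℝ := (((k + 1 - m : ℕ) : ℝ) * x + ((k + 1 : ℕ) - ((k + 1 - m : ℕ) : ℝ)) * y) / (k + 1 : ℕ)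
      with hz
    have hcast : ((k + 1 - m : ℕ) : ℝ) = (k + 1 : ℕ) - m := by push_cast [Nat.cast_sub hmK]; ring
    have hz' : z = x + (m / (k + 1 : ℕ)) * (y - x) := by
      simp only [hz, hcast]; field_simp; ring
    have hθ : (m : ℝ) / (k + 1 : ℕ) ≤ b := by rw [div_le_iff₀ hKpos]; exact hmle
    have hθ' : b - 1 / (k + 1 : ℕ) ≤ (m : ℝ) / (k + 1 : ℕ) := by
      have h : b ≤ ((m : ℝ) + 1) / (k + 1 : ℕ) := by rw [le_div_iff₀ hKpos]; linarith
      rw [add_div] at h; linarith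
    have ha' : a = 1 - b := by linarith
    have hdiff : a * x + b * y - (x + m / (k + 1 : ℕ) * (y - x)) = (b - m / (k + 1 : ℕ)) * (y - x) := by
      rw [ha']; ring
    have hzw : z ≤ w := by
      rw [hz', hw, ← sub_nonneg, hdiff]
      exact mul_nonneg (by linarith) (by linarith)
    have hwz : w - z ≤ (y - x) / (k + 1 : ℕ) := by
      rw [hz', hw, hdiff]
      calc (b - m / (k + 1 : ℕ)) * (y - x) ≤ (1 / (k + 1 : ℕ)) * (y - x) :=
            mul_le_mul_of_nonneg_right (by linarith) (by linarith)
        _ = (y - x) / (k + 1 : ℕ) := by ring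
    have hz0 : 0 ≤ z := by
      rw [hz']
      have := mul_nonneg (div_nonneg (Nat.cast_nonneg m) hKpos.le) (sub_nonneg.2 hxy)
      linarith
    -- rational concavity at `z`, then continuity from `z` up to `w`
    have hrat := pressureTT'_ratConcave hβ t t' hU hx0 hx2 hy0 hy2 k (k + 1 - m) (Nat.sub_le _ _)
    rw [← hz] at hrat
    have hmono := density_mul_le_pressureTT'_sub hβ t t' hU hz0 hzw hw2
    rw [← hD] at hmono
    have hcoef1 : ((k + 1 - m : ℕ) : ℝ) / (k + 1 : ℕ) = 1 - m / (k + 1 : ℕ) := by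
      rw [hcast]; field_simp
    have hcoef2 : (((k + 1 : ℕ) : ℝ) - ((k + 1 - m : ℕ) : ℝ)) / (k + 1 : ℕ) = m / (k + 1 : ℕ) := by
      rw [hcast]; ring_nf
    rw [hcoef1, hcoef2] at hrat
    have hd1 : |(1 - (m : ℝ) / (k + 1 : ℕ) - a) * px| ≤ |px| / (k + 1 : ℕ) := by
      rw [abs_mul, div_eq_mul_one_div |px|, mul_comm |px|]
      refine mul_le_mul_of_nonneg_right ?_ (abs_nonneg _)
      rw [abs_le]; constructor <;> linarith
    have hd2 : |((m : ℝ) / (k + 1 : ℕ) - b) * py| ≤ |py| / (k + 1 : ℕ) := by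
      rw [abs_mul, div_eq_mul_one_div |py|, mul_comm |py|]
      refine mul_le_mul_of_nonneg_right ?_ (abs_nonneg _)
      rw [abs_le]; constructor <;> linarith
    have hd1' := neg_abs_le ((1 - (m : ℝ) / (k + 1 : ℕ) - a) * px)
    have hd2' := neg_abs_le (((m : ℝ) / (k + 1 : ℕ) - b) * py)
    -- `(w - z) D ≥ -(w - z)|D| ≥ -|D|(y-x)/K`
    have hd3 : -(|D| * (y - x) / (k + 1 : ℕ)) ≤ (w - z) * D := by
      have h1 : -((w - z) * |D|) ≤ (w - z) * D := by
        rw [← mul_neg]; exact mul_le_mul_of_nonneg_left (neg_abs_le D) (sub_nonneg.2 hzw)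
      have h2 : (w - z) * |D| ≤ |D| * (y - x) / (k + 1 : ℕ) := by
        rw [mul_comm, mul_div_assoc]; exact mul_le_mul_of_nonneg_left hwz (abs_nonneg D)
      linarith
    have hCK : C / (k + 1 : ℕ) = |px| / (k + 1 : ℕ) + |py| / (k + 1 : ℕ) + |D| * (y - x) / (k + 1 : ℕ) := by
      simp only [hC]; rw [add_div, add_div]
    rw [hCK]
    linarith [hrat, hmono, hd1, hd2, hd1', hd2', hd3]
  -- let `k → ∞`
  refine le_of_forall_pos_le_add fun ε hε => ?_
  obtain ⟨k, hk⟩ := exists_nat_gt (C / ε)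
  have hk' : C / (k + 1 : ℕ) ≤ ε := by
    rw [div_le_iff₀ (by positivity)]
    rw [div_lt_iff₀ hε] at hk
    push_cast; nlinarith
  linarith [key k]

/-- **Box word in the density (two certified densities bind the interval between them):** for
`0 ≤ x ≤ n ≤ y < 2`, `min (p x) (p y) ≤ p n` — a pressure floor certified at the two endpoint fillings of a box
holds at every filling of the box. [cite: Ruelle1969, §3.4] -/
theorem min_pressureTT'_le_of_mem_Icc {x n y : ℝ} (hx0 : 0 ≤ x) (hxn : x ≤ n) (hny : n ≤ y) (hy2 : y < 2) :
    min (pressureTT' β t t' U x) (pressureTT' β t t' U y) ≤ pressureTT' β t t' U n := by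
  have hc := concaveOn_pressureTT'_density hβ t t' hU
  refine hc.ge_on_segment ⟨hx0, lt_of_le_of_lt (hxn.trans hny) hy2⟩ ⟨hx0.trans (hxn.trans hny), hy2⟩ ?_
  rw [segment_eq_Icc (hxn.trans hny)]
  exact ⟨hxn, hny⟩

/-- **Chord bound:** for `0 ≤ x < y < 2` and `x ≤ n ≤ y` the pressure lies above the chord,
`((y − n) p(x) + (n − x) p(y))/(y − x) ≤ p(n)`. [cite: Ruelle1969, §3.4] -/
theorem chord_le_pressureTT' {x n y : ℝ} (hx0 : 0 ≤ x) (hxn : x ≤ n) (hny : n ≤ y) (hxy : x < y) (hy2 : y < 2) :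
    ((y - n) / (y - x)) * pressureTT' β t t' U x + ((n - x) / (y - x)) * pressureTT' β t t' U y ≤
      pressureTT' β t t' U n := by
  have hc := concaveOn_pressureTT'_density hβ t t' hU
  have hyx : 0 < y - x := sub_pos.2 hxy
  have h := hc.2 ⟨hx0, hxy.trans hy2⟩ ⟨hx0.trans hxy.le, hy2⟩ (div_nonneg (sub_nonneg.2 hny) hyx.le)
    (div_nonneg (sub_nonneg.2 hxn) hyx.le) (by field_simp; ring)
  have e : ((y - n) / (y - x)) • x + ((n - x) / (y - x)) • y = n := by
    rw [smul_eq_mul, smul_eq_mul]; field_simp; ring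
  rw [e, smul_eq_mul, smul_eq_mul] at h
  exact h

end RationalLimit

end ThermodynamicLimit

end Literature.MathematicalPhysics.QuantumLattice
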